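import Literature.AlgebraicTopology.SingularHomology.FundamentalClassExistence
import Literature.AlgebraicTopology.SingularHomology.NoncompactManifoldProofs
import Literature.AlgebraicTopology.SingularHomology.LocalHomologyIso
import Literature.AlgebraicTopology.SingularHomology.LocalHomologyVanishing
import HarnessLib

/-!
# Puncturing an acyclic oriented manifold: the complement of a compact core maps onto `Hₙ`

Topic `Literature/AlgebraicTopology/SingularHomology`. Let `X` be a topological `(n+1)`-manifold
(`X : Type`, Hausdorff, `ChartedSpace (EuclideanSpace ℝ (Fin (n + 1))) X`) which is *acyclic in
degrees `n` and `n + 1`* (`Hₙ(X; R) = 0 = Hₙ₊₁(X; R)`), let `μ` be an `R`-orientation of `X`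
(Hatcher, *Algebraic Topology* (2002), §3.3, p. 235), let `K ⊆ X` be compact and `c ∈ K`. This file
proves, from the long exact sequences of the pairs `(X, X ∖ K)` and `(X, X ∖ c)` and Hatcher's
Lemma 3.27 (a) (existence of the class `μ_K`), the following facts about the punctured manifold
`X ∖ c`:

* `relativeSingularHomology.isIso_δ_of_isZero`: for any pair `(X, A)`, if `Hₙ₊₁(X) = 0 = Hₙ(X)`
  then `∂ : Hₙ₊₁(X, A) → Hₙ(A)` is an isomorphism (exactness; Hatcher Thm. 2.16).
* `HomologicalOrientation.exists_restrictToPoint_eq_of_isCompact`: **Lemma 3.27 (a), existence,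
  for compact subsets of (possibly non-compact) manifolds of dimension `≥ 1`**: an `R`-orientation is
  represented on every compact `K` by a class `μ_K ∈ Hₙ(X | K; R)` restricting to `μₓ` at all
  `x ∈ K` (the tree had this for `K = X` compact, `isRepresentedOn_univ`; the proof is the same
  finite induction over compact neighbourhoods, with the uniqueness input
  `clocalHomology.ptDetermined_of_isCompact` of `NoncompactManifoldProofs.lean`).
* `HomologicalOrientation.δ_localClass_generates`: `Hₙ(X ∖ c; R)` is generated by
  `∂ μ_c`, and is `≅ R` (`nonempty_iso_singularHomology_compl_singleton`).
* `HomologicalOrientation.map_compl_surjective` (**the main result**): the map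
  `Hₙ(X ∖ K; R) → Hₙ(X ∖ c; R)` induced by the inclusion is SURJECTIVE: by naturality of `∂`,
  `∂ μ_c = ∂ (μ_K|_c) = ι_* (∂ μ_K)` lies in its range, and generates.
* `isZero_singularHomology_compl_singleton_of_isZero`: `Hₖ(X ∖ c; R) = 0` whenever `Hₖ(X; R) = 0`
  and `k ≠ n` (`Hₖ₊₁(X | c) = 0` for `k + 1 ≠ n + 1`).

This is the homological core of the degree argument in Kervaire–Milnor's Lemma 2.3 (*Groups of
homotopy spheres I* (1963), p. 506: the boundary `M = bW'` of a contractible `W'` maps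
isomorphically onto `Hₙ` of `W' ∖ (ball)`), in a form that avoids Poincaré–Lefschetz duality: it is
applied (in `Literature/Topology/FourManifolds`) to the interior `X` of `W'`, the compact core `K`
being the complement of an open collar of the boundary, so that `X ∖ K ≃ M`.

## References

* A. Hatcher, *Algebraic Topology*, CUP 2002, §2.1 Thm. 2.16 (long exact sequence of the pair,
  naturality of `∂`), §3.3 pp. 233–236, Lemma 3.27. [HatcherAT2002]
* M. Kervaire, J. Milnor, *Groups of homotopy spheres I*, Ann. of Math. (2) 77 (1963), proof of
  Lemma 2.3 (p. 506). [KervaireMilnorAnnals1963]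
-/

noncomputable section

open CategoryTheory Limits Set Filter
open scoped Topology

universe u v

namespace Literature.AlgebraicTopology.SingularHomology

/-! ### `∂` is an isomorphism when the ambient space is acyclic in two consecutive degrees -/

section DeltaIso

variable (R : Type v) [CommRing R] (M : Type v) [AddCommGroup M] [Module R M]
variable {X : Type u} [TopologicalSpace X]

namespace relativeSingularHomology

/-- **`∂ : Hₙ₊₁(X, A) → Hₙ(A)` is injective when `Hₙ₊₁(X) = 0`** (exactness of
`Hₙ₊₁(X) → Hₙ₊₁(X, A) → Hₙ(A)`, Hatcher 2002, Thm. 2.16). [cite: HatcherAT2002, Thm. 2.16] -/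
theorem mono_δ_of_isZero (A : Set X) (n : ℕ) (h : IsZero (singularHomology R M X (n + 1))) :
    Mono (δ R M X A n) :=
  (exact_ofAbsolute_δ R M A n).mono_g (h.eq_of_src _ _)

/-- **`∂ : Hₙ₊₁(X, A) → Hₙ(A)` is surjective when `Hₙ(X) = 0`** (exactness of
`Hₙ₊₁(X, A) → Hₙ(A) → Hₙ(X)`, Hatcher 2002, Thm. 2.16). [cite: HatcherAT2002, Thm. 2.16] -/
theorem epi_δ_of_isZero (A : Set X) (n : ℕ) (h : IsZero (singularHomology R M X n)) :
    Epi (δ R M X A n) :=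
  (exact_δ_map R M A n).epi_f (h.eq_of_tgt _ _)

/-- **`∂ : Hₙ₊₁(X, A) ≅ Hₙ(A)` when `Hₙ₊₁(X) = 0 = Hₙ(X)`** (long exact sequence of the pair,
Hatcher 2002, Thm. 2.16; e.g. `X` contractible and `n ≥ 1`). [cite: HatcherAT2002, Thm. 2.16] -/
theorem isIso_δ_of_isZero (A : Set X) (n : ℕ) (h₁ : IsZero (singularHomology R M X (n + 1)))
    (h₀ : IsZero (singularHomology R M X n)) : IsIso (δ R M X A n) :=
  haveI := mono_δ_of_isZero R M A n h₁
  haveI := epi_δ_of_isZero R M A n h₀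
  isIso_of_mono_of_epi _

/-- **`Hₙ(A) = 0` when `Hₙ₊₁(X, A) = 0 = Hₙ(X)`** (exactness at `Hₙ(A)`, Hatcher 2002,
Thm. 2.16). [cite: HatcherAT2002, Thm. 2.16] -/
theorem isZero_of_isZero_relative_of_isZero (A : Set X) (n : ℕ)
    (h₁ : IsZero (relativeSingularHomology R M X A (n + 1)))
    (h₀ : IsZero (singularHomology R M X n)) : IsZero (singularHomology R M A n) :=
  (exact_δ_map R M A n).isZero_of_both_zeros (h₁.eq_of_src _ _) (h₀.eq_of_tgt _ _)

end relativeSingularHomology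

end DeltaIso

/-! ### Lemma 3.27 (a), existence, for compact subsets of non-compact manifolds -/

section Represented

variable {R : Type v} [CommRing R]
variable {X : Type u} [TopologicalSpace X] {n : ℕ}

namespace HomologicalOrientation

/-- Being represented is inherited by subsets (restrict the representing class). [folklore] -/
lemma IsRepresentedOn.mono {μ : HomologicalOrientation R X n} {K L : Set X} (h : L ⊆ K)
    (hK : μ.IsRepresentedOn K) : μ.IsRepresentedOn L := by
  obtain ⟨α, hα⟩ := hK
  refine ⟨clocalHomology.res R R X h n α, fun x hx => ?_⟩
  rw [← hα x (h hx)]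
  change (clocalHomology.res R R X h n ≫ clocalHomology.res R R X _ n) α = _
  rw [clocalHomology.res_comp_res]

/-- **Hatcher's Lemma 3.27 (a), existence, for compact subsets**: on a Hausdorff topological
`n`-manifold `X : Type`, `n ≥ 1` (not necessarily compact), every `R`-orientation `μ` is
represented on every compact `K ⊆ X` by a class of the concrete `Hₙ(X | K; R)` restricting to
`μₓ` at all `x ∈ K`: finite induction over compact neighbourhoods carrying local classes
(`exists_isCompact_mem_nhds_isRepresentedOn`, `IsRepresentedOn.union`), the uniqueness on overlaps
being `clocalHomology.ptDetermined_of_isCompact` (Lemma 3.27 (b), proved in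
`NoncompactManifoldProofs.lean`). [cite: HatcherAT2002, Lemma 3.27] -/
theorem isRepresentedOn_of_isCompact {X : Type} [TopologicalSpace X] [T2Space X]
    [ChartedSpace (EuclideanSpace ℝ (Fin n)) X] (hn : 1 ≤ n) (μ : HomologicalOrientation R X n)
    {K : Set X} (hK : IsCompact K) : μ.IsRepresentedOn K := by
  haveI : LocallyCompactSpace X := ChartedSpace.locallyCompactSpace (EuclideanSpace ℝ (Fin n)) X
  choose C hCc hCx hCμ using μ.exists_isCompact_mem_nhds_isRepresentedOn
  obtain ⟨t, ht⟩ := hK.elim_finite_subcover (fun x => interior (C x)) (fun _ => isOpen_interior)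
    fun x _ => Set.mem_iUnion.2 ⟨x, mem_interior_iff_mem_nhds.2 (hCx x)⟩
  have key : ∀ s : Finset X, IsCompact (⋃ x ∈ s, C x) ∧ μ.IsRepresentedOn (⋃ x ∈ s, C x) := by
    classical
    intro s
    induction s using Finset.induction_on with
    | empty =>
      simp only [Finset.notMem_empty, Set.iUnion_of_empty, Set.iUnion_empty]
      exact ⟨isCompact_empty, μ.isRepresentedOn_empty⟩
    | @insert a s ha ih =>
      rw [Finset.set_biUnion_insert]
      exact ⟨(hCc a).union ih.1, IsRepresentedOn.union (hCc a) ih.1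
        (clocalHomology.ptDetermined_of_isCompact R R hn ((hCc a).inter_right ih.1.isClosed))
        (hCμ a) ih.2⟩
  refine (key t).2.mono (ht.trans (Set.iUnion₂_mono fun x _ => interior_subset))

/-- **The class `μ_K ∈ Hₙ(X | K; R)` of a compact subset** (Hatcher 2002, Lemma 3.27 (a); p. 236:
"let `ℳ_R → M` be the covering space … `μ_K`"), in Mathlib's model of relative homology
`Hₙ(X | K) = Hₙ(X, X ∖ K)`: on a Hausdorff topological `n`-manifold `X : Type`, `n ≥ 1`, for every
`R`-orientation `μ` and every compact `K` there is `μ_K ∈ Hₙ(X, X ∖ K; R)` whose restriction to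
`Hₙ(X | x; R)` is `μₓ` for all `x ∈ K` (transport of `isRepresentedOn_of_isCompact` along the
comparison of the two models of relative homology). [cite: HatcherAT2002, Lemma 3.27] -/
theorem exists_restrictToPoint_eq_of_isCompact {X : Type} [TopologicalSpace X] [T2Space X]
    [ChartedSpace (EuclideanSpace ℝ (Fin n)) X] (hn : 1 ≤ n) (μ : HomologicalOrientation R X n)
    {K : Set X} (hK : IsCompact K) :
    ∃ α : localHomologyOfSet R R X K n, ∀ (x : X) (hx : x ∈ K),
      restrictToPoint R R hx n α = μ.localClass x := by
  obtain ⟨α', hα'⟩ := μ.isRepresentedOn_of_isCompact hn hK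
  refine ⟨(localHomologyOfSet.cmpIso R R X K n).inv α', fun x hx => ?_⟩
  have hnat := localHomologyOfSet.cmpIso_hom_comp_res R R (X := X) (Set.singleton_subset_iff.2 hx) n
  -- move everything to the concrete model, where `α'` restricts to `μ.clocalClass x`
  apply ((localHomologyOfSet.cmpIso R R X {x} n).toLinearEquiv).injective
  change ((restrictToPoint R R hx n ≫ (localHomologyOfSet.cmpIso R R X {x} n).hom)
      ((localHomologyOfSet.cmpIso R R X K n).inv α')) = μ.clocalClass x
  rw [restrictToPoint, ← hnat]
  change clocalHomology.res R R X _ n (((localHomologyOfSet.cmpIso R R X K n).inv ≫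
    (localHomologyOfSet.cmpIso R R X K n).hom) α') = _
  rw [Iso.inv_hom_id]
  exact hα' x hx

end HomologicalOrientation

end Represented

/-! ### Puncturing an acyclic oriented manifold -/

section Puncture

variable {R : Type v} [CommRing R]
variable {X : Type} [TopologicalSpace X] [T2Space X] {n : ℕ}
  [ChartedSpace (EuclideanSpace ℝ (Fin (n + 1))) X]

namespace HomologicalOrientation

omit [T2Space X] [ChartedSpace (EuclideanSpace ℝ (Fin (n + 1))) X] in
/-- The local orientation class generates `Hₙ₊₁(X | c; R)`: every element is `r • μ_c`
(`μ_c` corresponds to `1 ∈ R` under an `R`-linear identification `Hₙ₊₁(X | c; R) ≃ R`; Hatcher 2002,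
§3.3, p. 235). [cite: HatcherAT2002, §3.3 p. 235] -/
theorem exists_eq_smul_localClass (μ : HomologicalOrientation R X (n + 1)) (c : X)
    (z : localHomology R R X c (n + 1)) : ∃ r : R, z = r • μ.localClass c := by
  obtain ⟨e, he⟩ := μ.isGenerator c
  refine ⟨e z, e.injective ?_⟩
  rw [map_smul, he, smul_eq_mul, mul_one]

omit [T2Space X] [ChartedSpace (EuclideanSpace ℝ (Fin (n + 1))) X] in
/-- **`Hₙ(X ∖ c; R)` is generated by `∂ μ_c`** when `Hₙ₊₁(X; R) = 0 = Hₙ(X; R)`: `∂` is then an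
isomorphism `Hₙ₊₁(X | c) ≅ Hₙ(X ∖ c)` and `μ_c` generates the local homology (Hatcher 2002, §3.3
p. 231 with Thm. 2.16). [cite: HatcherAT2002, §3.3 p. 231] -/
theorem δ_localClass_generates (μ : HomologicalOrientation R X (n + 1)) (c : X)
    (h₁ : IsZero (singularHomology R R X (n + 1))) (h₀ : IsZero (singularHomology R R X n))
    (y : singularHomology R R ↥(({c}ᶜ : Set X)) n) :
    ∃ r : R, y = r • relativeSingularHomology.δ R R X {c}ᶜ n (μ.localClass c) := by
  haveI := relativeSingularHomology.isIso_δ_of_isZero R R ({c}ᶜ : Set X) n h₁ h₀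
  obtain ⟨z, rfl⟩ := (ModuleCat.epi_iff_surjective (relativeSingularHomology.δ R R X {c}ᶜ n)).1
    inferInstance y
  obtain ⟨r, rfl⟩ := μ.exists_eq_smul_localClass c z
  exact ⟨r, by rw [map_smul]⟩

omit [T2Space X] [ChartedSpace (EuclideanSpace ℝ (Fin (n + 1))) X] in
/-- `∂ μ_c = ι_* (∂ α)` for any class `α ∈ Hₙ₊₁(X | K)` restricting to `μ_c` at `c ∈ K`, where
`ι : X ∖ K ↪ X ∖ c` (naturality of `∂` for the map of pairs `(X, X ∖ K) → (X, X ∖ c)`, Hatcher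
2002, §2.1). [cite: HatcherAT2002, §2.1 (naturality of ∂)] -/
theorem δ_localClass_eq_map_δ (μ : HomologicalOrientation R X (n + 1)) (c : X) {K : Set X}
    (hc : c ∈ K) (α : localHomologyOfSet R R X K (n + 1))
    (hα : restrictToPoint R R hc (n + 1) α = μ.localClass c) :
    relativeSingularHomology.δ R R X {c}ᶜ n (μ.localClass c) =
      singularHomology.map R R (subsetRestrict (ContinuousMap.id X)
        (fun _ hx => Set.compl_subset_compl.2 (Set.singleton_subset_iff.2 hc) hx)) n
        (relativeSingularHomology.δ R R X Kᶜ n α) := by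
  rw [← hα]
  change (relativeSingularHomology.map R R (ContinuousMap.id X) _ (n + 1) ≫
      relativeSingularHomology.δ R R X {c}ᶜ n) α =
    (relativeSingularHomology.δ R R X Kᶜ n ≫ singularHomology.map R R _ n) α
  rw [relativeSingularHomology.δ_naturality]

/-- **The complement of a compact core maps ONTO `Hₙ` of the punctured manifold.** Let `X : Type`
be a Hausdorff topological `(n+1)`-manifold with `Hₙ₊₁(X; R) = 0 = Hₙ(X; R)`, `R`-oriented by `μ`,
let `K ⊆ X` be compact and `c ∈ K`. Then the map `Hₙ(X ∖ K; R) → Hₙ(X ∖ c; R)` induced by the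
inclusion is surjective: `Hₙ(X ∖ c)` is generated by `∂ μ_c` (`δ_localClass_generates`), and
`∂ μ_c = ∂ (μ_K|_c) = ι_* (∂ μ_K)` for the class `μ_K` of Lemma 3.27 (a)
(`exists_restrictToPoint_eq_of_isCompact`, `δ_localClass_eq_map_δ`). This is the homological core
of the degree argument in Kervaire–Milnor's Lemma 2.3 (1963, p. 506), for `X` the interior of a
contractible bounding manifold and `K` the complement of an open collar of its boundary.
[cite: HatcherAT2002, Lemma 3.27 and Thm. 2.16] [cite: KervaireMilnorAnnals1963, Lemma 2.3, proof (p. 506)] -/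
theorem map_compl_surjective (μ : HomologicalOrientation R X (n + 1)) (c : X)
    (h₁ : IsZero (singularHomology R R X (n + 1))) (h₀ : IsZero (singularHomology R R X n))
    {K : Set X} (hK : IsCompact K) (hc : c ∈ K) :
    Function.Surjective (singularHomology.map R R (subsetRestrict (ContinuousMap.id X)
      (fun _ hx => Set.compl_subset_compl.2 (Set.singleton_subset_iff.2 hc) hx) :
        C(↥((Kᶜ : Set X)), ↥(({c}ᶜ : Set X)))) n) := by
  intro y
  obtain ⟨r, rfl⟩ := μ.δ_localClass_generates c h₁ h₀ y
  obtain ⟨α, hα⟩ := μ.exists_restrictToPoint_eq_of_isCompact (Nat.succ_pos n) hK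
  refine ⟨r • relativeSingularHomology.δ R R X Kᶜ n α, ?_⟩
  rw [map_smul, μ.δ_localClass_eq_map_δ c hc α (hα c hc)]

/-- **`Hₙ(X ∖ c; R) ≅ R`** for a point `c` of a Hausdorff topological `(n+1)`-manifold `X : Type`
with `Hₙ₊₁(X; R) = 0 = Hₙ(X; R)`: `∂ : Hₙ₊₁(X | c) ≅ Hₙ(X ∖ c)` and `Hₙ₊₁(X | c; R) ≅ R`
(`nonempty_localHomology_iso_holds`). [cite: HatcherAT2002, §3.3 p. 231] -/
theorem nonempty_iso_singularHomology_compl_singleton (c : X)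
    (h₁ : IsZero (singularHomology R R X (n + 1))) (h₀ : IsZero (singularHomology R R X n)) :
    Nonempty (singularHomology R R ↥(({c}ᶜ : Set X)) n ≅ ModuleCat.of R (ULift.{0} R)) := by
  haveI := relativeSingularHomology.isIso_δ_of_isZero R R ({c}ᶜ : Set X) n h₁ h₀
  obtain ⟨i⟩ := nonempty_localHomology_iso_holds R X (n := n + 1) c
  exact ⟨(asIso (relativeSingularHomology.δ R R X {c}ᶜ n)).symm ≪≫ i⟩

end HomologicalOrientation

/-- **`Hₖ(X ∖ c; M) = 0` off the top degree**: for a point `c` of a Hausdorff topological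
`(n+1)`-manifold `X : Type` and `k ≠ n`, if `Hₖ(X; M) = 0` then `Hₖ(X ∖ c; M) = 0` (exactness of
`Hₖ₊₁(X | c) → Hₖ(X ∖ c) → Hₖ(X)` and `Hₖ₊₁(X | c; M) = 0` for `k + 1 ≠ n + 1`,
`isZero_localHomology_holds`). [cite: HatcherAT2002, §3.3 p. 231 and Thm. 2.16] -/
theorem isZero_singularHomology_compl_singleton_of_isZero {M : Type v} [AddCommGroup M]
    [Module R M] (c : X) {k : ℕ} (hk : k ≠ n) (h₀ : IsZero (singularHomology R M X k)) :
    IsZero (singularHomology R M ↥(({c}ᶜ : Set X)) k) :=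
  relativeSingularHomology.isZero_of_isZero_relative_of_isZero R M ({c}ᶜ : Set X) k
    (isZero_localHomology_holds (R := R) (M := M) X (n := n + 1) c (k := k + 1) (by omega)) h₀

end Puncture

end Literature.AlgebraicTopology.SingularHomology

end
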